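import Summits.CriticalPhenomena.PercolationContinuityZ3.Theorems.PercNearOneGluingNoHeavyLowerTailSahiOneStepFibreThresholdAll
import Summits.CriticalPhenomena.PercolationContinuityZ3.Theorems.PercNearOneGluingNoHeavyLowerTailSahiOneStepLumpedPartition
import HarnessLib

/-!
# One-step scheme: Kahn C5 / Sahi C₃ for EVERY threshold first slot, CONDITIONAL on the TREE-LUMP inequality

Support file (prover prim-ineq-prove-3 gen 18; `--supports stmt-CriticalPhenomena-4575`; memo
`run/shared/lean/prim/prim-ineq-prove-3/FINDING-G18-TREE-LUMP.md` §1–§2).  No definitions, no named facts, no sorries, no `native_decide`.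

For a linearly ordered index type, a block `F`, a threshold `t` and a `t`-subset `K ⊆ F`, the FIRST-PASSAGE SUB-CUBE of `K` is the cylinder
`C_K = {ω | ω ∩ P_K = K}`, `P_K = {i ∈ F | ∃ k ∈ K, i ≤ k}` (the coordinates of `F` up to the largest element of `K`): the configurations whose first
`t` open coordinates of `F` are exactly `K`.  These cylinders partition `H = Th_t(F) = {ω | t ≤ #(F ∩ ω)}` (`cylFP_subset_threshold`,
`cylFP_pairwiseDisjoint`, `threshold_subset_iUnion_cylFP`).  By `…SahiOneStepLumpedPartition` (Harris on each cylinder + the lumped reduction) the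
`(2′)` one-step hypothesis for `(H, A, B)` follows from the single inequality

  `TREE-LUMP(F,t;A,B):  μ(A)μ(B) ≤ Σ_{K} μ(A∩C_K)μ(B∩C_K)/μ(C_K) + μ(A∩Hᶜ)μ(B∩Hᶜ)/μ(Hᶜ)`

(positive correlation of the block averages of `1_A, 1_B` for the partition `{Hᶜ} ∪ {C_K}`), and with the `(3′)` half `osMp_threshold_nonneg` (all
thresholds, gen 17) and the one-step theorem `sahiE3_nonneg_of_ind`:  **TREE-LUMP for the F-determined up-sets ⟹ `E₃(Th_t(F), A, B) ≥ 0` for ALL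
increasing `A, B`** (`sahiE3_threshold_nonneg_of_treeLump`).  TREE-LUMP is verified (d ≤ 6, all orders, memo §2) and its coefficientwise form cTL
exhaustively for d ≤ 5 (kit j140750); it is NOT proved here.
-/

noncomputable section

namespace Summit.CriticalPhenomena.PercolationContinuityZ3.Theorems

namespace SahiOneStep

open MeasureTheory Finset
open Literature.Probability.Percolation (DeterminedBy determinedBy_iff)
open Literature.Probability.LatticeModels (prodBernoulli sahiE3)
open Literature.Probability.Percolation.DecisionTree (ind)
open scoped Classical

variable {ι : Type*} [Fintype ι] [LinearOrder ι]

/-! ## Initial segments of a finite set in a linear order -/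

omit [Fintype ι] in
/-- Every finite set `S` has, for each `t ≤ |S|`, an INITIAL SEGMENT of size `t` (a subset closed downwards inside `S`). [folklore] -/
theorem exists_initialSegment (S : Finset ι) :
    ∀ t : ℕ, t ≤ S.card → ∃ I : Finset ι, I ⊆ S ∧ I.card = t ∧ ∀ i ∈ I, ∀ j ∈ S, j ≤ i → j ∈ I := by
  intro t
  induction t with
  | zero =>
    intro _
    exact ⟨∅, Finset.empty_subset _, Finset.card_empty, fun i hi => absurd hi (Finset.notMem_empty i)⟩
  | succ t ih =>
    intro ht
    obtain ⟨I, hIS, hIcard, hIinit⟩ := ih (Nat.le_of_succ_le ht)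
    have hne : (S \ I).Nonempty := by
      rw [← Finset.card_pos, Finset.card_sdiff_of_subset hIS]
      omega
    set m := (S \ I).min' hne with hm
    have hmS : m ∈ S \ I := Finset.min'_mem _ hne
    have hmI : m ∉ I := (Finset.mem_sdiff.1 hmS).2
    refine ⟨insert m I, ?_, ?_, ?_⟩
    · exact Finset.insert_subset (Finset.mem_sdiff.1 hmS).1 hIS
    · rw [Finset.card_insert_of_notMem hmI, hIcard]
    · intro i hi j hj hji
      rcases Finset.mem_insert.1 hi with rfl | hiI
      · by_cases hjI : j ∈ I
        · exact Finset.mem_insert_of_mem hjI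
        · have hjm : (S \ I).min' hne ≤ j := Finset.min'_le _ _ (Finset.mem_sdiff.2 ⟨hj, hjI⟩)
          rw [← hm] at hjm
          rw [le_antisymm hji hjm]
          exact Finset.mem_insert_self _ _
      · exact Finset.mem_insert_of_mem (hIinit i hiI j hj hji)

/-! ## The first-passage cylinders of `Th_t(F)` -/

omit [Fintype ι] in
/-- A first-passage cylinder lies inside the threshold event: `ω ∩ P_K = K`, `|K| = t`, `K ⊆ F` force `t ≤ #(F ∩ ω)`. [this work] -/
theorem cylFP_subset_threshold (F : Finset ι) (t : ℕ) {K : Finset ι} (hK : K ∈ F.powersetCard t) :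
    {ω : Set ι | ω ∩ (↑(F.filter fun i => ∃ k ∈ K, i ≤ k) : Set ι) = ↑K} ⊆ {ω : Set ι | t ≤ (F.filter (· ∈ ω)).card} := by
  intro ω hω
  simp only [Set.mem_setOf_eq] at hω ⊢
  obtain ⟨hKF, hKcard⟩ := Finset.mem_powersetCard.1 hK
  rw [← hKcard]
  refine Finset.card_le_card fun k hk => Finset.mem_filter.2 ⟨hKF hk, ?_⟩
  have : (k : ι) ∈ (ω ∩ (↑(F.filter fun i => ∃ k ∈ K, i ≤ k) : Set ι)) := by rw [hω]; exact Finset.mem_coe.2 hk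
  exact this.1

omit [Fintype ι] in
/-- Distinct `t`-subsets of `F` give DISJOINT first-passage cylinders. [this work] -/
theorem cylFP_pairwiseDisjoint (F : Finset ι) (t : ℕ) :
    ((F.powersetCard t : Finset (Finset ι)) : Set (Finset ι)).PairwiseDisjoint
      fun K => {ω : Set ι | ω ∩ (↑(F.filter fun i => ∃ k ∈ K, i ≤ k) : Set ι) = ↑K} := by
  intro K hK K' hK' hne
  rw [Function.onFun, Set.disjoint_left]
  intro ω hω hω'
  simp only [Set.mem_setOf_eq] at hω hω'
  have hKt := (Finset.mem_powersetCard.1 (Finset.mem_coe.1 hK)).2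
  have hK't := (Finset.mem_powersetCard.1 (Finset.mem_coe.1 hK')).2
  have hKF := (Finset.mem_powersetCard.1 (Finset.mem_coe.1 hK)).1
  have hK'F := (Finset.mem_powersetCard.1 (Finset.mem_coe.1 hK')).1
  -- membership facts
  have memK : ∀ k ∈ K, (k : ι) ∈ ω := fun k hk => by
    have : (k : ι) ∈ ω ∩ (↑(F.filter fun i => ∃ k ∈ K, i ≤ k) : Set ι) := by rw [hω]; exact Finset.mem_coe.2 hk
    exact this.1
  have memK' : ∀ k ∈ K', (k : ι) ∈ ω := fun k hk => by
    have : (k : ι) ∈ ω ∩ (↑(F.filter fun i => ∃ k ∈ K', i ≤ k) : Set ι) := by rw [hω']; exact Finset.mem_coe.2 hk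
    exact this.1
  -- generic step: if every element of `K₁` lies below some element of `K₂` then `K₁ ⊆ K₂`
  have step : ∀ K₁ K₂ : Finset ι, K₁ ⊆ F → (∀ k ∈ K₁, (k : ι) ∈ ω) →
      ω ∩ (↑(F.filter fun i => ∃ k ∈ K₂, i ≤ k) : Set ι) = ↑K₂ → (∀ k ∈ K₁, ∃ k' ∈ K₂, k ≤ k') → K₁ ⊆ K₂ := by
    intro K₁ K₂ h1F h1ω h2 hbelow k hk
    have hmem : (k : ι) ∈ ω ∩ (↑(F.filter fun i => ∃ k ∈ K₂, i ≤ k) : Set ι) :=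
      ⟨h1ω k hk, Finset.mem_coe.2 (Finset.mem_filter.2 ⟨h1F hk, hbelow k hk⟩)⟩
    rw [h2] at hmem
    exact Finset.mem_coe.1 hmem
  -- either every element of `K` is below some element of `K'`, or some `k ∈ K` is above all of `K'`
  by_cases hall : ∀ k ∈ K, ∃ k' ∈ K', k ≤ k'
  · have hsub : K ⊆ K' := step K K' hKF memK hω' hall
    exact hne (Finset.eq_of_subset_of_card_le hsub (by rw [hKt, hK't]))
  · push Not at hall
    obtain ⟨k, hk, habove⟩ := hall
    have hsub : K' ⊆ K := step K' K hK'F memK' hω fun k' hk' => ⟨k, hk, le_of_lt (habove k' hk')⟩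
    exact hne (Finset.eq_of_subset_of_card_le hsub (by rw [hKt, hK't])).symm

omit [Fintype ι] in
/-- The first-passage cylinders COVER the threshold event: the first `t` open coordinates of `F` form the index `K`. [this work] -/
theorem threshold_subset_iUnion_cylFP (F : Finset ι) (t : ℕ) :
    {ω : Set ι | t ≤ (F.filter (· ∈ ω)).card} ⊆
      ⋃ K ∈ F.powersetCard t, {ω : Set ι | ω ∩ (↑(F.filter fun i => ∃ k ∈ K, i ≤ k) : Set ι) = ↑K} := by
  intro ω hω
  simp only [Set.mem_setOf_eq] at hω
  obtain ⟨I, hIS, hIcard, hIinit⟩ := exists_initialSegment (F.filter (· ∈ ω)) t hω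
  simp only [Set.mem_iUnion, Set.mem_setOf_eq, exists_prop]
  refine ⟨I, Finset.mem_powersetCard.2 ⟨hIS.trans (Finset.filter_subset _ _), hIcard⟩, ?_⟩
  ext i
  simp only [Set.mem_inter_iff, Finset.coe_filter, Set.mem_setOf_eq, Finset.mem_coe]
  constructor
  · rintro ⟨hiω, hiF, k, hk, hik⟩
    exact hIinit k hk i (Finset.mem_filter.2 ⟨hiF, hiω⟩) hik
  · intro hi
    have hi' := Finset.mem_filter.1 (hIS hi)
    exact ⟨hi'.2, hi'.1, i, hi, le_rfl⟩

/-! ## TREE-LUMP ⟹ the `(2′)` hypothesis ⟹ Kahn C5 for the threshold slot -/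

/-- **`(2′)` from TREE-LUMP.**  If the block averages of `1_A, 1_B` over the first-passage partition `{Hᶜ} ∪ {C_K : K ∈ F.powersetCard t}` of
`H = Th_t(F)` are positively correlated, then `0 ≤ n(1_A,1_B)`. [this work] -/
theorem osN_threshold_nonneg_of_treeLump (p : ι → unitInterval) (F : Finset ι) (t : ℕ) {A B : Set (Set ι)}
    (hA : IsUpperSet A) (hB : IsUpperSet B)
    (hTL : (prodBernoulli p).real A * (prodBernoulli p).real B ≤
      (∑ K ∈ F.powersetCard t,
          (prodBernoulli p).real (A ∩ {ω : Set ι | ω ∩ (↑(F.filter fun i => ∃ k ∈ K, i ≤ k) : Set ι) = ↑K}) *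
            (prodBernoulli p).real (B ∩ {ω : Set ι | ω ∩ (↑(F.filter fun i => ∃ k ∈ K, i ≤ k) : Set ι) = ↑K}) /
            (prodBernoulli p).real {ω : Set ι | ω ∩ (↑(F.filter fun i => ∃ k ∈ K, i ≤ k) : Set ι) = ↑K})
        + (prodBernoulli p).real (A ∩ {ω : Set ι | t ≤ (F.filter (· ∈ ω)).card}ᶜ) *
            (prodBernoulli p).real (B ∩ {ω : Set ι | t ≤ (F.filter (· ∈ ω)).card}ᶜ) /
            (prodBernoulli p).real {ω : Set ι | t ≤ (F.filter (· ∈ ω)).card}ᶜ) :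
    0 ≤ osN p {ω : Set ι | t ≤ (F.filter (· ∈ ω)).card} (ind A) (ind B) :=
  osN_ind_ind_nonneg_of_lumped_cylinders p hA hB (F.powersetCard t) (fun K => F.filter fun i => ∃ k ∈ K, i ≤ k) (fun K => (↑K : Set ι))
    (fun _ hK => cylFP_subset_threshold F t hK) (cylFP_pairwiseDisjoint F t) (threshold_subset_iUnion_cylFP F t) hTL

/-- **KAHN C5 / SAHI C₃ FOR EVERY THRESHOLD FIRST SLOT, CONDITIONAL ON TREE-LUMP.**  If TREE-LUMP(F,t;A,B) holds for all increasing
`F`-determined `A, B`, then `E₃(Th_t(F), A, B) ≥ 0` for ALL increasing `A, B ⊆ 2^ι` (the `(3′)` half is `osMp_threshold_nonneg`, unconditional).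
[this work] -/
theorem sahiE3_threshold_nonneg_of_treeLump (p : ι → unitInterval) (F : Finset ι) (t : ℕ)
    (hTL : ∀ A B : Set (Set ι), IsUpperSet A → IsUpperSet B → DeterminedBy A (↑F : Set ι) → DeterminedBy B (↑F : Set ι) →
      (prodBernoulli p).real A * (prodBernoulli p).real B ≤
        (∑ K ∈ F.powersetCard t,
            (prodBernoulli p).real (A ∩ {ω : Set ι | ω ∩ (↑(F.filter fun i => ∃ k ∈ K, i ≤ k) : Set ι) = ↑K}) *
              (prodBernoulli p).real (B ∩ {ω : Set ι | ω ∩ (↑(F.filter fun i => ∃ k ∈ K, i ≤ k) : Set ι) = ↑K}) /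
              (prodBernoulli p).real {ω : Set ι | ω ∩ (↑(F.filter fun i => ∃ k ∈ K, i ≤ k) : Set ι) = ↑K})
          + (prodBernoulli p).real (A ∩ {ω : Set ι | t ≤ (F.filter (· ∈ ω)).card}ᶜ) *
              (prodBernoulli p).real (B ∩ {ω : Set ι | t ≤ (F.filter (· ∈ ω)).card}ᶜ) /
              (prodBernoulli p).real {ω : Set ι | t ≤ (F.filter (· ∈ ω)).card}ᶜ)
    {A B : Set (Set ι)} (hA : IsUpperSet A) (hB : IsUpperSet B) :
    0 ≤ sahiE3 (prodBernoulli p) {ω : Set ι | t ≤ (F.filter (· ∈ ω)).card} A B :=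
  sahiE3_nonneg_of_ind p (determinedBy_threshold F t)
    (fun _ _ hA' hB' hAF hBF => osMp_threshold_nonneg p F t hA' hB' hAF hBF)
    (fun A' B' hA' hB' hAF hBF => osN_threshold_nonneg_of_treeLump p F t hA' hB' (hTL A' B' hA' hB' hAF hBF)) hA hB

end SahiOneStep

end Summit.CriticalPhenomena.PercolationContinuityZ3.Theorems
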